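import Summits.QuantumAdvantage.QuantumAdvantage.Theorems.JointFreenessLawA
import Summits.QuantumAdvantage.QuantumAdvantage.Theorems.InnerDegreeLawsC

set_option linter.dupNamespace false

/-!
# Joint freeness law, part C (lens 4, g29): a pair-free set inside a direction class (first moment)

The selection step between part A (a direction class `J` whose pencil rows are structured over the free set `I`, with light
vectors `s j`, `wtOn B (s j) < w`) and part B (the bilinear normal form on a PAIR-FREE `Fs ⊆ J`): the bad `2`-sets `{j, l} ⊆ J`
(`l ≠ j`, `s j l ≠ 0`) number at most `Σ_{j ∈ J} wtOn B (s j) < |J|·w`, so by the first moment (tree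
`InnerDegreeDial.exists_card_avoiding`, applied on the subtype `↥J`) an `f`-subset of `J` avoiding all of them exists as soon as
`#bad · C(|J|−2, f−2) < C(|J|, f)` (roughly `w f² < |J|`, the count quoted in `(c0)` (P5)/(P2) and `(c0)₂` step 4).
* `badPairs J s`, `card_of_mem_badPairs` (every bad set has exactly two elements), `card_badPairs_le`;
* `exists_pairFree` — the pair-free `Fs ⊆ J`, `|Fs| = f`.
Supports stmt-QuantumAdvantage-28487 (record; the residual `X = AbsorptionDial.NoPerfectPolyOdd` is NOT claimed).
-/

namespace Summit.QuantumAdvantage.QuantumAdvantage.Theorems.JointFreeness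

open Finset

variable {F : Type*} [Field F] {n : ℕ}

section PairFree

variable [DecidableEq F] (J : Finset (Fin n)) (s : Fin n → Fin n → F)

/-- the bad `2`-subsets of (the subtype of) `J`: `{j, l}` with `l ≠ j` and `s j l ≠ 0` -/
noncomputable def badPairs : Finset (Finset J) := by
  classical exact ((J.attach ×ˢ J.attach).filter (fun jl => jl.1 ≠ jl.2 ∧ s jl.1 jl.2 ≠ 0)).image (fun jl => {jl.1, jl.2})

/-- every bad set has exactly two elements -/
theorem card_of_mem_badPairs {b : Finset J} (hb : b ∈ badPairs J s) : b.card = 2 := by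
  classical
  unfold badPairs at hb
  obtain ⟨jl, hjl, rfl⟩ := mem_image.mp hb
  exact card_pair (mem_filter.mp hjl).2.1

/-- the number of bad sets is at most the total in-class off-diagonal weight of the light vectors -/
theorem card_badPairs_le : (badPairs J s).card ≤ ∑ j ∈ J, (J.filter fun l => l ≠ j ∧ s j l ≠ 0).card := by
  classical
  unfold badPairs
  refine card_image_le.trans ?_
  set P := (J.attach ×ˢ J.attach).filter (fun jl : J × J => jl.1 ≠ jl.2 ∧ s jl.1 jl.2 ≠ 0) with hP
  -- count the filtered pairs fibrewise over the first coordinate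
  have hfib : P.card = ∑ a ∈ J.attach, (P.filter fun jl => jl.1 = a).card :=
    card_eq_sum_card_fiberwise fun jl _ => mem_attach J jl.1
  rw [hfib, ← Finset.sum_attach J]
  refine sum_le_sum fun a _ => ?_
  refine card_le_card_of_injOn (fun jl => (jl.2 : Fin n)) (fun jl hjl => ?_) (fun jl₁ hjl₁ jl₂ hjl₂ heq => ?_)
  · rw [mem_coe, mem_filter, hP, mem_filter] at hjl
    obtain ⟨⟨_, hne, hs⟩, hj1⟩ := hjl
    rw [mem_coe, mem_filter]
    refine ⟨jl.2.2, ?_, ?_⟩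
    · intro h
      exact hne (hj1.trans (Subtype.ext h).symm)
    · rw [← hj1]; exact hs
  · rw [mem_coe, mem_filter] at hjl₁ hjl₂
    have h1 : jl₁.1 = jl₂.1 := hjl₁.2.trans hjl₂.2.symm
    have h2 : jl₁.2 = jl₂.2 := Subtype.ext heq
    exact Prod.ext h1 h2

/-- the in-class off-diagonal weight of a light vector is less than `w` when its weight on `B ⊇ J` is -/
theorem inClass_weight_lt {B : Finset (Fin n)} (hJB : J ⊆ B) {w : ℕ} {j : Fin n} (hw : wtOn B (s j) < w) :
    (J.filter fun l => l ≠ j ∧ s j l ≠ 0).card < w := by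
  have hsub : (J.filter fun l => l ≠ j ∧ s j l ≠ 0) ⊆ B.filter (fun l => s j l ≠ 0) := by
    intro l hl
    rw [mem_filter] at hl ⊢
    exact ⟨hJB hl.1, hl.2.2⟩
  have hcard : (B.filter fun l => s j l ≠ 0).card = wtOn B (s j) := by
    unfold wtOn
    exact congrArg Finset.card (Finset.filter_congr_decidable _ _ _).symm
  calc (J.filter fun l => l ≠ j ∧ s j l ≠ 0).card ≤ (B.filter fun l => s j l ≠ 0).card := card_le_card hsub
    _ = wtOn B (s j) := hcard
    _ < w := hw

/-- **a pair-free set inside a direction class (first moment).**  If `#badPairs · C(|J| − 2, f − 2) < C(|J|, f)` then some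
`Fs ⊆ J` with `|Fs| = f` is pair-free for the light vectors: `s j l = 0` for all `j ≠ l` in `Fs`. -/
theorem exists_pairFree (f : ℕ) (h : (badPairs J s).card * (J.card - 2).choose (f - 2) < J.card.choose f) :
    ∃ Fs : Finset (Fin n), Fs ⊆ J ∧ Fs.card = f ∧ ∀ j ∈ Fs, ∀ l ∈ Fs, l ≠ j → s j l = 0 := by
  classical
  have hsum : ∑ b ∈ badPairs J s, (Fintype.card J - b.card).choose (f - b.card) < (Fintype.card J).choose f := by
    rw [Fintype.card_coe]
    calc ∑ b ∈ badPairs J s, (J.card - b.card).choose (f - b.card)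
        = ∑ b ∈ badPairs J s, (J.card - 2).choose (f - 2) := sum_congr rfl fun b hb => by rw [card_of_mem_badPairs J s hb]
      _ = (badPairs J s).card * (J.card - 2).choose (f - 2) := by rw [sum_const, smul_eq_mul]
      _ < J.card.choose f := h
  obtain ⟨T, hTcard, hTavoid⟩ := InnerDegreeDial.exists_card_avoiding (α := J) f (badPairs J s) hsum
  refine ⟨T.map (Function.Embedding.subtype _), fun x hx => ?_, by rw [card_map, hTcard], fun j hj l hl hlj => ?_⟩
  · obtain ⟨a, _, rfl⟩ := mem_map.mp hx
    exact a.2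
  · obtain ⟨a, ha, rfl⟩ := mem_map.mp hj
    obtain ⟨b, hb, rfl⟩ := mem_map.mp hl
    by_contra hs
    have hab : a ≠ b := fun heq => hlj (by rw [heq])
    have hbad : ({a, b} : Finset J) ∈ badPairs J s := by
      unfold badPairs
      exact mem_image.mpr ⟨(a, b), mem_filter.mpr ⟨mem_product.mpr ⟨mem_attach _ _, mem_attach _ _⟩, hab, hs⟩, rfl⟩
    refine hTavoid _ hbad fun x hx => ?_
    rw [mem_insert, mem_singleton] at hx
    rcases hx with rfl | rfl
    · exact ha
    · exact hb

end PairFree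

end Summit.QuantumAdvantage.QuantumAdvantage.Theorems.JointFreeness
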